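import Summits.BirchSwinnertonDyer.Rank1Residual.Additive.X3BranchKummerLayerTwisted
import HarnessLib

/-!
# X3, the DEGENERATE rows OFF the sub-locus: `ζ₉` under the layer group — an element of `Γ_ℚ` fixing
# `θ = ζ₉ + ζ₉⁸` maps `ζ₉` to `ζ₉` or `ζ₉⁸ = ζ₉⁻¹`, according to its action on `ζ₃ = ζ₉³`
# (cell `bsd-eis`, seat `bsd-eis-x3` gen 7; fourth brick of the T-side over the first layer `ℚ_1`
# (MEMO-9 §2.4 (f)): the glue between the layer group `G₁` (which fixes `θ`,
# `Iwasawa/CyclotomicLayerOneCubic`) and the hypotheses `hfix` / `hflip` of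
# `KummerLayerTwisted.exists_twistedKummerChar` for radicals of elements `b = B(ζ₉) ∈ ℤ[ζ₉]`;
# route K1 `AdditiveBranchIMC`, crux `GordTwoRankZeroOffCaseOne` — supports only)

HONEST FRAMING (`run/shared/lean/pub/bsd-eis/README.md` §4): THEOREMS ONLY (no `def`, no named fact,
no `sorry`); nothing is booked; no label, tier or count of record moves.

## What

`K = ℚ(ζ₉) = ℚ_1(ζ₃)` is quadratic over the first layer `ℚ_1 = ℚ(θ)`, `θ = ζ₉ + ζ₉⁻¹`; an element
`σ ∈ Γ_ℚ` fixing `θ` permutes the two roots `ζ₉^{±1}` of `X² − θX + 1`: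
* `smul_zeta9_eq_or_of_smul_theta` — `σζ₉ ∈ {ζ₉, ζ₉⁸}` (from `xζ(x + x⁸ − ζ − ζ⁸) = (xζ − 1)(x − ζ)`
  for `x⁹ = ζ⁹ = 1`);
* `smul_zeta9_eq_self_of_smul_cube` / `smul_zeta9_eq_pow_eight_of_smul_cube_ne` — the case is decided
  by the action on `ζ₃ = ζ₉³` (`(ζ₉⁸)³ = ζ₉⁶ ≠ ζ₉³`);
* `smul_aeval_zeta9_eq_self` / `smul_aeval_zeta9_eq_aeval_pow_eight` — hence `σ(B(ζ₉)) = B(ζ₉)`, resp.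
  `= B(ζ₉⁸)`, for every integer polynomial `B` — the `hfix` / `hflip` inputs of the twisted descent.
References: [Washington1997] §2 (cyclotomic fields, `ℚ(ζ_n)⁺`); [SerreLocalFields1979] Ch. X §3.
-/

set_option autoImplicit false

noncomputable section

open scoped Classical

namespace Summit.BirchSwinnertonDyer.Rank1Residual.Additive

namespace KummerLayerTwisted

open Field Polynomial

/-- **`σζ₉ ∈ {ζ₉, ζ₉⁸}` for `σ` fixing `θ = ζ₉ + ζ₉⁸`.** With `x = σζ₉` (`x⁹ = 1`):
`xζ·(x + x⁸ − ζ − ζ⁸) = (xζ − 1)(x − ζ)`, so `x = ζ` or `xζ = 1`, i.e. `x = ζ⁸`. [folklore] -/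
theorem smul_zeta9_eq_or_of_smul_theta {ζ : AlgebraicClosure ℚ} (hζ : IsPrimitiveRoot ζ 9)
    {σ : absoluteGaloisGroup ℚ} (hθ : σ • (ζ + ζ ^ 8) = ζ + ζ ^ 8) :
    σ • ζ = ζ ∨ σ • ζ = ζ ^ 8 := by
  have hζ9 : ζ ^ 9 = 1 := hζ.pow_eq_one
  have hx9 : (σ • ζ) ^ 9 = 1 := by rw [← smul_pow', hζ9, smul_one]
  have hθ' : σ • ζ + (σ • ζ) ^ 8 = ζ + ζ ^ 8 := by rwa [smul_add, smul_pow'] at hθ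
  have key : (σ • ζ * ζ - 1) * (σ • ζ - ζ) = 0 := by
    linear_combination (σ • ζ * ζ) * hθ' - ζ * hx9 + (σ • ζ) * hζ9
  rcases mul_eq_zero.mp key with h | h
  · right
    -- `xζ = 1` and `ζ⁸ζ = 1` give `x = ζ⁸`
    have hζ0 : ζ ≠ 0 := hζ.ne_zero (by norm_num)
    have h1 : σ • ζ * ζ = ζ ^ 8 * ζ := by
      rw [sub_eq_zero] at h
      rw [h, ← pow_succ, hζ9]
    exact mul_right_cancel₀ hζ0 h1
  · left
    exact sub_eq_zero.mp h

/-- `ζ₉³` is a primitive cube root of unity. [folklore] -/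
theorem isPrimitiveRoot_zeta9_cube {ζ : AlgebraicClosure ℚ} (hζ : IsPrimitiveRoot ζ 9) :
    IsPrimitiveRoot (ζ ^ 3) 3 :=
  hζ.pow (by norm_num) (by norm_num)

/-- `ζ₉⁶ ≠ ζ₉³` (`ζ₉³ ≠ 1`). [folklore] -/
theorem zeta9_pow_six_ne_cube {ζ : AlgebraicClosure ℚ} (hζ : IsPrimitiveRoot ζ 9) :
    ζ ^ 6 ≠ ζ ^ 3 := by
  intro h
  have h3 : ζ ^ 3 ≠ 0 := pow_ne_zero 3 (hζ.ne_zero (by norm_num))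
  have h1 : ζ ^ 3 * ζ ^ 3 = 1 * ζ ^ 3 := by rw [← pow_add, one_mul]; exact h
  have h31 : ζ ^ 3 = 1 := mul_right_cancel₀ h3 h1
  exact (hζ.pow_ne_one_of_pos_of_lt (by norm_num) (by norm_num)) h31

/-- **`σ` fixing `θ` and `ζ₃ = ζ₉³` fixes `ζ₉`.** [folklore] -/
theorem smul_zeta9_eq_self_of_smul_cube {ζ : AlgebraicClosure ℚ} (hζ : IsPrimitiveRoot ζ 9)
    {σ : absoluteGaloisGroup ℚ} (hθ : σ • (ζ + ζ ^ 8) = ζ + ζ ^ 8) (h3 : σ • ζ ^ 3 = ζ ^ 3) :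
    σ • ζ = ζ := by
  rcases smul_zeta9_eq_or_of_smul_theta hζ hθ with h | h
  · exact h
  · exfalso
    rw [smul_pow', h, ← pow_mul, show 8 * 3 = 9 * 2 + 6 from rfl, pow_add, pow_mul, hζ.pow_eq_one,
      one_pow, one_mul] at h3
    exact zeta9_pow_six_ne_cube hζ h3

/-- **`σ` fixing `θ` and moving `ζ₃ = ζ₉³` maps `ζ₉` to `ζ₉⁸ = ζ₉⁻¹`.** [folklore] -/
theorem smul_zeta9_eq_pow_eight_of_smul_cube_ne {ζ : AlgebraicClosure ℚ} (hζ : IsPrimitiveRoot ζ 9)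
    {σ : absoluteGaloisGroup ℚ} (hθ : σ • (ζ + ζ ^ 8) = ζ + ζ ^ 8) (h3 : σ • ζ ^ 3 ≠ ζ ^ 3) :
    σ • ζ = ζ ^ 8 := by
  rcases smul_zeta9_eq_or_of_smul_theta hζ hθ with h | h
  · exact absurd (by rw [smul_pow', h]) h3
  · exact h

/-- **`σ(B(ζ₉)) = B(σζ₉)`** for an integer polynomial `B` (`σ` is a ring automorphism fixing `ℤ`).
[folklore] -/
theorem smul_aeval_eq (B : ℤ[X]) (σ : absoluteGaloisGroup ℚ) (x : AlgebraicClosure ℚ) :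
    σ • aeval x B = aeval (σ • x) B := by
  have h := Polynomial.hom_eval₂ B (Int.castRingHom (AlgebraicClosure ℚ))
    (MulSemiringAction.toRingHom (absoluteGaloisGroup ℚ) (AlgebraicClosure ℚ) σ) x
  rw [MulSemiringAction.toRingHom_apply, MulSemiringAction.toRingHom_apply,
    RingHom.ext_int ((MulSemiringAction.toRingHom (absoluteGaloisGroup ℚ) (AlgebraicClosure ℚ) σ).comp
      (Int.castRingHom (AlgebraicClosure ℚ))) (Int.castRingHom (AlgebraicClosure ℚ))] at h
  rw [aeval_def, aeval_def]
  exact h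

/-- **`hfix`**: `σ` fixing `θ` and `ζ₃` fixes every `B(ζ₉)`, `B ∈ ℤ[X]`. [folklore] -/
theorem smul_aeval_zeta9_eq_self {ζ : AlgebraicClosure ℚ} (hζ : IsPrimitiveRoot ζ 9) (B : ℤ[X])
    {σ : absoluteGaloisGroup ℚ} (hθ : σ • (ζ + ζ ^ 8) = ζ + ζ ^ 8) (h3 : σ • ζ ^ 3 = ζ ^ 3) :
    σ • aeval ζ B = aeval ζ B := by
  rw [smul_aeval_eq, smul_zeta9_eq_self_of_smul_cube hζ hθ h3]

/-- **`hflip`**: `σ` fixing `θ` and moving `ζ₃` maps `B(ζ₉)` to `B(ζ₉⁸)`, `B ∈ ℤ[X]`. [folklore] -/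
theorem smul_aeval_zeta9_eq_aeval_pow_eight {ζ : AlgebraicClosure ℚ} (hζ : IsPrimitiveRoot ζ 9)
    (B : ℤ[X]) {σ : absoluteGaloisGroup ℚ} (hθ : σ • (ζ + ζ ^ 8) = ζ + ζ ^ 8)
    (h3 : σ • ζ ^ 3 ≠ ζ ^ 3) : σ • aeval ζ B = aeval (ζ ^ 8) B := by
  rw [smul_aeval_eq, smul_zeta9_eq_pow_eight_of_smul_cube_ne hζ hθ h3]

end KummerLayerTwisted

end Summit.BirchSwinnertonDyer.Rank1Residual.Additive

end
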